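import Mathlib
import HarnessLib
import Summits.ValiantsHypothesis.ValiantsHypothesis.Theses.MonotoneRestoration
import Literature.Computability.AlgebraicComplexity.ArithCircuit
import Literature.Computability.AlgebraicComplexity.ArithCircuitProofs
import Literature.Computability.AlgebraicComplexity.MonotoneStructure
import Literature.Computability.AlgebraicComplexity.PermanentIrreducible
import Literature.ModelTheory.FiniteModelTheory.CkEquiv
import Summits.ValiantsHypothesis.ValiantsHypothesis.Theorems.MonotoneRestorationMonotoneRestorationQPCosetCount
import Summits.ValiantsHypothesis.ValiantsHypothesis.Theorems.MonotoneRestorationMonotoneRestorationQPSymmetricLB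
import Summits.ValiantsHypothesis.ValiantsHypothesis.Theorems.MonotoneRestorationMonotoneRestorationQPSupportSymmetrisation
import Summits.ValiantsHypothesis.ValiantsHypothesis.Theorems.MonotoneRestorationMonotoneRestorationQPSparseRegime
import Summits.ValiantsHypothesis.ValiantsHypothesis.Theorems.MonotoneRestorationMonotoneRestorationQPBeta
import Literature.Computability.AlgebraicComplexity.SymmetricArithCircuit
import Literature.Computability.AlgebraicComplexity.DawarWilsenach2025Proofs
import Literature.GroupTheory.PermutationGroups.SmallIndexSubgroups
import Summits.ValiantsHypothesis.ValiantsHypothesis.Theorems.MonotoneRestorationQP.Negative.LoadBearing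
import Summits.ValiantsHypothesis.ValiantsHypothesis.Theorems.MonotoneRestorationMonotoneRestorationQPPermSupportCount

/-! TTRL-lite variant V19155 of stmt-ValiantsHypothesis-15886

Target `stub_gateSupport`, move `lemma_proposal`: for every gate `g` of a labelled arithmetic circuit
on the matrix variables `Fin n × Fin n`, the permutations `ρ ∈ Sym_n` admitting a circuit automorphism
`π` that extends `ρ` and fixes `g` form a subgroup of `Sym_n` (the "stabiliser of `g` downstairs").
This is the structural step of the support theorem (`stub_gateSupport`): closure under `1`, `*` and
`⁻¹` is exactly `isAutomorphismExtending_one` / `.trans` / `.inv` of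
`Literature/Computability/AlgebraicComplexity/DawarWilsenach2025Proofs.lean`, and the membership
characterisation is definitional.
-/

-- `Summit.ValiantsHypothesis.ValiantsHypothesis.…` is the tree's mandated single-conjunct layout
-- (Sub = Summit), so the duplicated namespace component is intended.
set_option linter.dupNamespace false

namespace Summit.ValiantsHypothesis.ValiantsHypothesis.Theorems

open Summit.ValiantsHypothesis.ValiantsHypothesis.Theses.MonotoneRestoration
open Literature.Computability.AlgebraicComplexity

/-- **TTRL-lite variant V19155 of `stub_gateSupport`** (the gate stabiliser is a subgroup).
For a labelled arithmetic circuit `C` on the variables `Fin n × Fin n` and a gate `g`, there is a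
subgroup `S ≤ Sym_n` whose members are exactly the permutations `ρ` having an automorphism `π` of `C`
extending `ρ` with `π g = g`: the identity extends `1`, inverses of extensions extend inverses, and
products of extensions extend products. [cite: DawarWilsenach2025, Def. 3.6 and §6 (support theorem)] -/
theorem stub_gateSupport_var19155 :
    ∀ (n : ℕ) (K : Type) (G : Type) (C : LabelledArithCircuit K (Fin n × Fin n) Unit G) (g : G),
      ∃ S : Subgroup (Equiv.Perm (Fin n)), ∀ ρ : Equiv.Perm (Fin n),
        ρ ∈ S ↔ ∃ π : Equiv.Perm G, C.IsAutomorphismExtending ρ π ∧ π g = g := by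
  intro n K G C g
  refine ⟨{ carrier := {ρ | ∃ π : Equiv.Perm G, C.IsAutomorphismExtending ρ π ∧ π g = g}
            mul_mem' := ?_
            one_mem' := ⟨1, C.isAutomorphismExtending_one, rfl⟩
            inv_mem' := ?_ }, fun ρ => Iff.rfl⟩
  · rintro a b ⟨πa, ha, hag⟩ ⟨πb, hb, hbg⟩
    exact ⟨πa * πb, hb.trans ha, by rw [Equiv.Perm.mul_apply, hbg, hag]⟩
  · rintro a ⟨πa, ha, hag⟩
    exact ⟨πa⁻¹, ha.inv, by rw [Equiv.Perm.inv_eq_iff_eq, hag]⟩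

end Summit.ValiantsHypothesis.ValiantsHypothesis.Theorems
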